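import Summits.BirchSwinnertonDyer.Rank1Residual.Additive.MinimalGoodReductionField
import Summits.BirchSwinnertonDyer.Rank1Residual.Additive.GordFieldOrdinary
import HarnessLib

/-!
# X3♯/X4♯ (G-ord): Delbourgo's standing hypothesis "(G) + potential good ORDINARY reduction" read on the minimal (G)-field

HONEST FRAMING (cell `b2b-bsdres`, run/shared/lean/b2b/bsd-rank1-residual/, verbatim in every
file): the goal of the cell is to DELETE the COMBINATION-SHAPED residual classes of the
Birch–Swinnerton-Dyer formula for ALL analytic-rank `≤ 1` elliptic curves over `ℚ` — "full BSD
formula for every rank `≤ 1` curve in class `C`" assembled STRICTLY from published theorems — so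
that the rank-`≤ 1` remainder becomes exactly the CONSTRUCTION-SHAPED classes, which are TYPED
(missing-input `Prop`s), NOT attempted. This is not "finishing BSD". Sub-cell `additive-p2`
(CLASS-OWNERS row "X3/X4 additive — pot. good ordinary / X3♯(G-ord)"), generation 5: research
route; no claim beyond the stated classes; theorems only, no definition, no new named fact;
X3♯(G-ord)/X4♯(G-ord) stay CONSTRUCTION-SHAPED.

WHAT THIS FILE DOES. Combines `MinimalGoodReductionField.lean` (the minimal (G)-field `F₀ ⊆ ℚ(ζ_p)`
of degree `e_E(p)`; the (G)-fields are exactly the subfields containing `F₀`) with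
`GordFieldOrdinary.lean` (on every (G)-field a (G)-ordinary additive pair is good ORDINARY):

* `typeGOrd_iff_exists_intermediateField_finrank_eq_semistabilityIndex` — **`TypeGOrd W p` (the
  standing hypothesis of Delbourgo 1998 Thm. 3 / Prop. 4 / Main Conjecture: "(G) + potential good
  ORDINARY reduction") iff the subfield of degree `e_E(p)` of (any) `p`-th cyclotomic field exists
  and `E` is good with the unit-root condition over it above `p`** (`p ≥ 5`, `E` additive at `p`,
  `W` globally minimal);
* `TypeGOrd.forall_good_and_unitRoot_iff_minimal_le` — for a (G)-ordinary additive pair and every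
  subfield `F ⊆ ℚ(ζ_p)`: `E_F` is good ordinary above `p` iff `F₀ ≤ F`;
* `typeGOrd_iff_typeG_of_semistabilityIndex_ne_two` — on the defect-`3,4,6` cell
  `TypeGOrd ↔ TypeG` outright (ordinarity automatic: `j̃ ∈ {0, 1728}`), complementing gen 4's
  `typeGOrd_iff_goodOrd_twist_pStar` on the defect-`2` cell (ordinarity = the twist datum).

So the sub-cell's theory class is read on ONE canonical object per pair: the integer
`e_E(p) ∈ {2,3,4,6}` with `e_E(p) ∣ p − 1`, the field `F₀`, and — only when `e_E(p) = 2` — one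
ordinarity bit. Located gap / labels / census UNCHANGED (HOME/b2b-bsdres-additive-p2/AUDIT-X34-GORD.md).

References: D. Delbourgo, Compositio Math. 113 (1998) §1.3, §1.5, Thm. 3, Prop. 4, §2.5;
J. H. Silverman, *AEC* V.4.1, VII.5.4–5.5; L. C. Washington, *Introduction to Cyclotomic Fields*, Ch. 2.
-/

noncomputable section

open scoped Classical NumberField

open WeierstrassCurve IsDedekindDomain NumberField Literature.NumberTheory.EllipticCurves
  Literature.NumberTheory.EllipticCurves.Rank1Residual

namespace Summit.BirchSwinnertonDyer.Rank1Residual.Additive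

variable (W : WeierstrassCurve ℚ) [W.IsElliptic] [W.IsGloballyMinimal] (p : ℕ) [hp : Fact p.Prime]
  (L : Type) [Field L] [NumberField L] [hcyc : IsCyclotomicExtension {p} ℚ L]

/-- **(G)-ordinary read on the minimal field** (`p ≥ 5`, `E` additive at `p`, `W` globally
minimal, `L` any `p`-th cyclotomic field): `TypeGOrd W p` iff there is a subfield `F ⊆ L` of degree
`e_E(p)` over which `E` is good with the unit-root condition above `p` (then `F` is the unique
subfield of that degree, `TypeG.existsUnique_minimal_field`). -/
theorem typeGOrd_iff_exists_intermediateField_finrank_eq_semistabilityIndex (hp5 : 5 ≤ p)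
    (hadd : Addv W p) :
    TypeGOrd W p ↔ ∃ F : IntermediateField ℚ L, Module.finrank ℚ F = semistabilityIndex W p ∧
      ∀ w : HeightOneSpectrum (𝓞 F), (p : 𝓞 F) ∈ w.asIdeal →
        (W.baseChange F).HasGoodReductionAt w ∧ (W.baseChange F).HasUnitRootAt w := by
  constructor
  · intro hG
    obtain ⟨F, hFd, hF⟩ :=
      (typeG_iff_exists_intermediateField_finrank_eq_semistabilityIndex W p L hp5).mp hG.typeG
    exact ⟨F, hFd,
      (TypeGOrd.forall_good_and_unitRoot_iff_forall_good W p F hp5 hG hadd).mpr hF⟩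
  · rintro ⟨F, -, hF⟩
    exact ⟨L, inferInstance, inferInstance, hcyc, F, hF⟩

/-- **For a (G)-ordinary additive pair, `E_F` is good ORDINARY above `p` iff `F ⊇ F₀`**, the
subfield of degree `e_E(p)` (`p ≥ 5`, `W` globally minimal, `F` any subfield of `L`). -/
theorem TypeGOrd.forall_good_and_unitRoot_iff_minimal_le (hp5 : 5 ≤ p) (hG : TypeGOrd W p)
    (hadd : Addv W p) (F₀ : IntermediateField ℚ L)
    (hF₀ : Module.finrank ℚ F₀ = semistabilityIndex W p) (F : IntermediateField ℚ L) :
    (∀ w : HeightOneSpectrum (𝓞 F), (p : 𝓞 F) ∈ w.asIdeal →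
        (W.baseChange F).HasGoodReductionAt w ∧ (W.baseChange F).HasUnitRootAt w) ↔ F₀ ≤ F := by
  rw [TypeGOrd.forall_good_and_unitRoot_iff_forall_good W p F hp5 hG hadd,
    TypeG.forall_hasGoodReductionAt_iff_minimal_le W p L hp5 hG.typeG F₀ hF₀ F]

/-- **On the defect-`3,4,6` cell, (G)-ordinary = (G)** (`p ≥ 5`, `E` additive at `p`, `W` globally
minimal): `TypeGOrd W p ↔ TypeG W p` when `e_E(p) ≠ 2` — the (G)-field of degree `e_E(p)` exists by
`typeG_iff_exists_intermediateField_finrank_eq_semistabilityIndex` and ordinarity on it is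
automatic (`typeGOrd_of_typeG_of_semistabilityIndex_ne_two`). On the defect-`2` cell the extra
bit is genuine: gen 4's `typeGOrd_iff_goodOrd_twist_pStar`. -/
theorem typeGOrd_iff_typeG_of_semistabilityIndex_ne_two (hp5 : 5 ≤ p) (hadd : Addv W p)
    (hne2 : semistabilityIndex W p ≠ 2) : TypeGOrd W p ↔ TypeG W p := by
  refine ⟨TypeGOrd.typeG, fun hG ↦ ?_⟩
  -- any `p`-th cyclotomic field will do; take Mathlib's `CyclotomicField p ℚ`
  haveI : NeZero p := ⟨hp.out.ne_zero⟩
  haveI : IsCyclotomicExtension {p} ℚ (CyclotomicField p ℚ) :=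
    CyclotomicField.instIsCyclotomicExtensionSingletonNatSetOfCharZero p ℚ
  haveI : NumberField (CyclotomicField p ℚ) := IsCyclotomicExtension.numberField {p} ℚ _
  obtain ⟨F, -, hF⟩ :=
    (typeG_iff_exists_intermediateField_finrank_eq_semistabilityIndex W p (CyclotomicField p ℚ)
      hp5).mp hG
  exact typeGOrd_of_typeG_of_semistabilityIndex_ne_two W p hp5 hadd hG hne2 F hF

end Summit.BirchSwinnertonDyer.Rank1Residual.Additive

end
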